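import Mathlib
import Summits.Ventures.HodgeRepro.Tier4.Common.LocalCoordinates

/-!
# Tier4/Common/LocalUnitary — the UNITARY RELATION of the local coordinates `locMat q w g ∈ M₂(ℂ)` of a row plane at a
real CM place: `locMat g * J * (locMat g)ᴴ = J` with `J = diag (a_w, ε_w b_w)`, and its scalar consequences
`a_w ‖α‖² + ε_w b_w ‖β‖² = a_w`, `‖α‖ ≥ 1`, `α ≠ 0` on `U(1,1)`, `α(g⁻¹) = conj α(g)`

Blind re-derivation cell `pub-hodge-repro`, Tier 4 «prove the step» (README §9–§10), seat t4-typer-2 (gen 4), on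
t4-L1-p5 g4's TAKE (S14786) of the offer S14784 (C-COMMON-LOCALU11), companion of `Common/LocalCoordinates.lean` (the
`400`-line rule splits the module).  Target tree path `lean/Summits/Ventures/HodgeRepro/Tier4/Common/LocalUnitary.lean`.
Imports: Mathlib + `Common.LocalCoordinates` (`blocksOf`, `blocks_eq_blockOf`, `locEntry`, `locMat`, `locMat_mul`,
`locMat_one`; through it RowPlane / RowTorus / RowWeights / MixedPlaneKType).

THE ARGUMENT.  `g B gᵀ = B` with `B = blockDiag(a G, ε b G)` (`G = lineGramRowR t n 1`), read block by block
(`unitary_block_eq`: `a • A G Aᵀ + ε b • B G Bᵀ = a • G`, `a • A G Cᵀ + ε b • B G Dᵀ = 0`, …), through the trace-form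
identity `(x + y ω) G (x′ + y′ ω)ᵀ = (z z̄′) G` with `z z̄′ = (x x′ + n y y′ + t x y′) + (y x′ − x y′) ω`
(`blockOf_mul_lineGramRowR_mul_transpose`): every block equation becomes `(a z₀ z̄₀′ + ε b z₁ z̄₁′ − δ c) G = 0`, and a block
annihilating `G` vanishes (`eq_zero_of_blockOf_mul_lineGramRowR_eq_zero`: `4 n − t²` and `2` are units), so
`a z₀ z̄₀′ + ε b z₁ z̄₁′ = δ c` in the coordinates (`block_unitary_scalar`, `locEntry_unitary`); read in `ℂ` through the
real place with `bw(z z̄′) = bw(z) · conj (bw(z′))` (`blockWeight_mul_conj`) this is **`locMat_mul_J_mul_star`**.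
Consequences: **`normSq_entry_sub_normSq`** (`a_w ‖α‖² + ε_w b_w ‖β‖² = a_w`), **`one_le_normSq_locEntry_zero_zero`** /
**`one_le_norm_locEntry_zero_zero`** / **`locEntry_zero_zero_ne_zero`** when `0 < a_w` and `ε_w b_w < 0` (the signature
`(1,1)` at `w`: the seesaw plane `mixedRow q a₀ a₂`, `ε = −1`, at a place with `a₀,w > 0`, `a₂,w > 0`); `locMat_inv_mul`,
`locMat_mul_inv`, **`locMat_inv_mul_J`** (`locMat g⁻¹ · J = J · (locMat g)ᴴ`), **`locEntry_inv_zero_zero`**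
(`α(g⁻¹) = conj α(g)`).  Consumer: C-L4-D3COEFF (`D3coeff q w₀ g := (locEntry q w₀ g 0 0)⁻¹ ^ 3`: continuity from
`α ≠ 0`, `‖D3coeff‖ ≤ 1` from `‖α‖ ≥ 1`, `cj`/`refl` from `α(g⁻¹) = conj α(g)`).  Hypothesis `hq : 4 n − t² ≠ 0` holds
whenever one real CM place exists (`IsCMAt`), and is kept explicit.

Nothing here says anything about the status of the Hodge conjecture for CM abelian varieties, which is NOT proved
(HC_CM is NOT proved by anyone in this repository).
-/

set_option autoImplicit false

noncomputable section

namespace Summit.Ventures.HodgeRepro.Tier4.Common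

open NumberField Matrix Set Topology
open scoped ComplexConjugate

section Unitary

variable {k : Type} [Field k] [NumberField k] (q : QuadData k) (a b ε : k) (w : InfinitePlace k)

/-! ## 1. The unitary relation -/

/-- **The trace-form identity on a block**: `(x + y ω) G_c (x′ + y′ ω)ᵀ = c · (z z̄′) G₁` with
`z z̄′ = (x x′ + n y y′ + t x y′) + (y x′ − x y′) ω` (over any commutative ring). -/
theorem blockOf_mul_lineGramRowR_mul_transpose {R : Type} [CommRing R] (t n c x y x' y' : R) :
    blockOf t n x y * lineGramRowR t n c * (blockOf t n x' y')ᵀ =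
      c • (blockOf t n (x * x' + n * y * y' + t * x * y') (y * x' - x * y') * lineGramRowR t n 1) := by
  ext i j
  fin_cases i <;> fin_cases j <;>
    simp [blockOf, omegaMatR, lineGramRowR, Matrix.mul_apply, Fin.sum_univ_two] <;> ring

/-- A scalar multiple of a block is a block. -/
theorem smul_blockOf {R : Type} [CommRing R] (t n c x y : R) :
    c • blockOf t n x y = blockOf t n (c * x) (c * y) := by
  ext i j
  fin_cases i <;> fin_cases j <;> simp [blockOf, omegaMatR] <;> ring

/-- A sum of blocks is a block. -/
theorem blockOf_add {R : Type} [CommRing R] (t n x y x' y' : R) :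
    blockOf t n x y + blockOf t n x' y' = blockOf t n (x + x') (y + y') := by
  ext i j
  fin_cases i <;> fin_cases j <;> simp [blockOf, omegaMatR] <;> ring

/-- The identity block. -/
theorem blockOf_one_zero {R : Type} [CommRing R] (t n : R) : blockOf t n 1 0 = 1 := by
  ext i j
  fin_cases i <;> fin_cases j <;> simp [blockOf, omegaMatR]

/-- **A block annihilating the Gram matrix is zero** (`4 n − t²` and `2` units): `(p + s ω) G₁ = 0 ⇒ p = s = 0`. -/
theorem eq_zero_of_blockOf_mul_lineGramRowR_eq_zero {R : Type} [CommRing R] {t n p s : R}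
    (hu : IsUnit (4 * n - t ^ 2)) (h2 : IsUnit (2 : R))
    (h : blockOf t n p s * lineGramRowR t n 1 = 0) : p = 0 ∧ s = 0 := by
  have h11 := congrFun (congrFun h 1) 1
  have h01 := congrFun (congrFun h 0) 1
  simp [blockOf, omegaMatR, lineGramRowR, Matrix.mul_apply, Fin.sum_univ_two] at h11 h01
  have hs : (4 * n - t ^ 2) * s = 0 := by linear_combination (-2) * h01 - t * h11
  have hs0 : s = 0 := (hu.mul_right_eq_zero).1 hs
  have hp : (2 : R) * p = 0 := by rw [hs0] at h11; linear_combination h11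
  exact ⟨(h2.mul_right_eq_zero).1 hp, hs0⟩

/-- `blockWeight` of a scalar multiple. -/
theorem blockWeight_smul (c x y : Ad k) :
    blockWeight q w (c * x) (c * y) = adToC w c * blockWeight q w x y := by
  simp only [blockWeight, map_mul]
  ring

/-- **The block weight of `z z̄′`** is `bw(z) · conj (bw(z′))` at a real CM place. -/
theorem blockWeight_mul_conj (hw : w.IsReal) (hcm : IsCMAt q w) (x y x' y' : Ad k) :
    blockWeight q w (x * x' + algebraMap k (Ad k) q.n * y * y' + algebraMap k (Ad k) q.t * x * y') (y * x' - x * y') =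
      blockWeight q w x y * conj (blockWeight q w x' y') := by
  have hx' : conj (adToC w x') = adToC w x' := Complex.conj_eq_iff_im.2 (adToC_im_eq_zero hw x')
  have hy' : conj (adToC w y') = adToC w y' := Complex.conj_eq_iff_im.2 (adToC_im_eq_zero hw y')
  simp only [blockWeight, map_add, map_mul, map_sub, adToC_t, adToC_n, hx', hy', conj_wroot hw]
  have hsq := wroot_sq hw hcm
  linear_combination (adToC w y * adToC w y') * hsq

/-- The adelic Gram matrix of the row plane: `blockDiag (G_a, G_{ε b})`. -/
theorem adMat_B_ofLinesRow :
    adMat k (PlaneData.ofLinesRow q a b ε).B =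
      re4R (fromBlocks (lineGramRowR (algebraMap k (Ad k) q.t) (algebraMap k (Ad k) q.n) (algebraMap k (Ad k) a)) 0 0
        (lineGramRowR (algebraMap k (Ad k) q.t) (algebraMap k (Ad k) q.n) (algebraMap k (Ad k) (ε * b)))) := by
  have h : (PlaneData.ofLinesRow q a b ε).B = blockDiag4 (lineGramRow q a) (lineGramRow q (ε * b)) := by
    show blockDiag4 (lineGramRow q a) (ε • lineGramRow q b) = _
    rw [smul_lineGramRow]
  rw [h, adMat_blockDiag4, lineGramRow_map, lineGramRow_map]
  rfl

/-- `re4R` commutes with transposition. -/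
theorem re4R_transpose (N : Matrix (Fin 2 ⊕ Fin 2) (Fin 2 ⊕ Fin 2) (Ad k)) : (re4R N)ᵀ = re4R Nᵀ := by
  simp only [re4R, coe_reindexAlgEquiv, transpose_reindex]

/-- **The block equations of unitarity**: for `g ∈ G(𝔸)` and every `I J`,
`a • (z_{I0} z̄_{J0}) G₁ + ε b • (z_{I1} z̄_{J1}) G₁ = (if I = J then c_I else 0) • G₁` on the blocks. -/
theorem unitary_block_eq (g : GA (PlaneData.ofLinesRow q a b ε)) (I J : Fin 2) :
    algebraMap k (Ad k) a • (blocksOf (GA.mat (PlaneData.ofLinesRow q a b ε) g) I 0 *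
        lineGramRowR (algebraMap k (Ad k) q.t) (algebraMap k (Ad k) q.n) 1 *
        (blocksOf (GA.mat (PlaneData.ofLinesRow q a b ε) g) J 0)ᵀ) +
      algebraMap k (Ad k) (ε * b) • (blocksOf (GA.mat (PlaneData.ofLinesRow q a b ε) g) I 1 *
        lineGramRowR (algebraMap k (Ad k) q.t) (algebraMap k (Ad k) q.n) 1 *
        (blocksOf (GA.mat (PlaneData.ofLinesRow q a b ε) g) J 1)ᵀ) =
      (if I = J then (if I = 0 then algebraMap k (Ad k) a else algebraMap k (Ad k) (ε * b)) else 0) •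
        lineGramRowR (algebraMap k (Ad k) q.t) (algebraMap k (Ad k) q.n) 1 := by
  set M := GA.mat (PlaneData.ofLinesRow q a b ε) g with hM
  have hG : ∀ c : Ad k, lineGramRowR (algebraMap k (Ad k) q.t) (algebraMap k (Ad k) q.n) c =
      c • lineGramRowR (algebraMap k (Ad k) q.t) (algebraMap k (Ad k) q.n) 1 := by
    intro c
    ext i j
    fin_cases i <;> fin_cases j <;> simp [lineGramRowR]
  have hB : M * adMat k (PlaneData.ofLinesRow q a b ε).B * Mᵀ = adMat k (PlaneData.ofLinesRow q a b ε).B :=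
    ((mem_unitaryGroup (PlaneData.ofLinesRow q a b ε) _).1 g.2).2
  rw [adMat_B_ofLinesRow, hG (algebraMap k (Ad k) a), hG (algebraMap k (Ad k) (ε * b))] at hB
  conv_lhs at hB => rw [eq_re4R_fromBlocks M]
  rw [re4R_transpose, fromBlocks_transpose, ← map_mul, ← map_mul, fromBlocks_multiply, fromBlocks_multiply] at hB
  have hB' := (re4R (R := Ad k)).injective hB
  simp only [Matrix.mul_zero, add_zero, zero_add, Matrix.mul_smul, Matrix.smul_mul] at hB'
  obtain ⟨h00, h01, h10, h11⟩ := fromBlocks_inj.1 hB'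
  fin_cases I <;> fin_cases J
  · simpa using h00
  · simpa using h01
  · simpa using h10
  · simpa using h11

/-- A difference of blocks is a block. -/
theorem blockOf_sub {R : Type} [CommRing R] (t n x y x' y' : R) :
    blockOf t n x y - blockOf t n x' y' = blockOf t n (x - x') (y - y') := by
  ext i j
  fin_cases i <;> fin_cases j <;> simp [blockOf, omegaMatR] <;> ring

/-- **The scalar content of a block equation of unitarity** (over any commutative ring with `4 n − t²` and `2`
units): from `a • (z₀ G z₀′ᵀ) + b • (z₁ G z₁′ᵀ) = d • G` read `a z₀ z̄₀′ + b z₁ z̄₁′ = d` in coordinates. -/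
theorem block_unitary_scalar {R : Type} [CommRing R] {t n aR bR x₀ y₀ x₀' y₀' x₁ y₁ x₁' y₁' d : R}
    (hu : IsUnit (4 * n - t ^ 2)) (h2 : IsUnit (2 : R))
    (h : aR • (blockOf t n x₀ y₀ * lineGramRowR t n 1 * (blockOf t n x₀' y₀')ᵀ) +
        bR • (blockOf t n x₁ y₁ * lineGramRowR t n 1 * (blockOf t n x₁' y₁')ᵀ) = d • lineGramRowR t n 1) :
    aR * (x₀ * x₀' + n * y₀ * y₀' + t * x₀ * y₀') + bR * (x₁ * x₁' + n * y₁ * y₁' + t * x₁ * y₁') = d ∧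
      aR * (y₀ * x₀' - x₀ * y₀') + bR * (y₁ * x₁' - x₁ * y₁') = 0 := by
  rw [blockOf_mul_lineGramRowR_mul_transpose, blockOf_mul_lineGramRowR_mul_transpose, one_smul, one_smul,
    ← Matrix.smul_mul, ← Matrix.smul_mul, smul_blockOf, smul_blockOf, ← Matrix.add_mul, blockOf_add] at h
  have hd : d • lineGramRowR t n 1 = blockOf t n d 0 * lineGramRowR t n 1 := by
    calc d • lineGramRowR t n 1 = (d • (1 : Matrix (Fin 2) (Fin 2) R)) * lineGramRowR t n 1 := by
          rw [Matrix.smul_mul, Matrix.one_mul]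
      _ = blockOf t n d 0 * lineGramRowR t n 1 := by
          rw [← blockOf_one_zero t n, smul_blockOf, mul_one, mul_zero]
  rw [hd, ← sub_eq_zero, ← Matrix.sub_mul, blockOf_sub] at h
  obtain ⟨hp, hs⟩ := eq_zero_of_blockOf_mul_lineGramRowR_eq_zero hu h2 h
  exact ⟨sub_eq_zero.1 hp, by simpa using hs⟩

/-- `locEntry` as the block weight of the matrix entries. -/
theorem locEntry_eq_blockWeight' (g : GA (PlaneData.ofLinesRow q a b ε)) (I J : Fin 2) :
    locEntry q a b ε w g I J = blockWeight q w (GA.mat (PlaneData.ofLinesRow q a b ε) g (lineBase I) (lineBase J))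
      (GA.mat (PlaneData.ofLinesRow q a b ε) g (lineOmega I) (lineBase J)) := by
  simp only [locEntry, blockWeight, entryAt_eq_adToC]

omit [NumberField k] in
/-- **`4 n − t² ≠ 0` in `k` at any real CM place** (`IsCMAt`: `t_w² < 4 n_w` strictly): the hypothesis `hq` of the
unitary relation is supplied by `hw`/`hcm`. -/
theorem disc_ne_zero_of_isCMAt (hw : w.IsReal) (hcm : IsCMAt q w) : 4 * q.n - q.t ^ 2 ≠ 0 := by
  intro h
  have h' : (4 : ℂ) * nAt q w - tAt q w ^ 2 = 0 := by
    have := congrArg (fun x : k => InfinitePlace.Completion.extensionEmbedding w (algebraMap k w.Completion x)) h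
    simpa only [map_sub, map_mul, map_pow, map_ofNat, map_zero, tAt, nAt] using this
  rw [tAt_eq_re hw, nAt_eq_re hw] at h'
  have hr : (4 : ℝ) * (nAt q w).re - (tAt q w).re ^ 2 = 0 := by exact_mod_cast h'
  unfold IsCMAt at hcm
  linarith

/-- `4 n − t²` is an adelic unit when it is non-zero in `k`. -/
theorem isUnit_disc (hq : 4 * q.n - q.t ^ 2 ≠ 0) :
    IsUnit (4 * algebraMap k (Ad k) q.n - algebraMap k (Ad k) q.t ^ 2) := by
  have h : 4 * algebraMap k (Ad k) q.n - algebraMap k (Ad k) q.t ^ 2 = algebraMap k (Ad k) (4 * q.n - q.t ^ 2) := by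
    simp only [map_sub, map_mul, map_pow, map_ofNat]
  rw [h]
  exact (isUnit_iff_ne_zero.2 hq).map (algebraMap k (Ad k))

/-- `2` is an adelic unit. -/
theorem isUnit_two_Ad : IsUnit (2 : Ad k) := by
  have h : (2 : Ad k) = algebraMap k (Ad k) 2 := (map_ofNat (algebraMap k (Ad k)) 2).symm
  rw [h]
  exact (isUnit_iff_ne_zero.2 two_ne_zero).map (algebraMap k (Ad k))

/-- **The scalar form of the unitary relation, entry `(I, J)`**:
`a_w z_{I0} z̄_{J0} + ε_w b_w z_{I1} z̄_{J1} = δ_{IJ} c_I` (`c₀ = a_w`, `c₁ = ε_w b_w`). -/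
theorem locEntry_unitary (hw : w.IsReal) (hcm : IsCMAt q w) (hq : 4 * q.n - q.t ^ 2 ≠ 0)
    (g : GA (PlaneData.ofLinesRow q a b ε)) (I J : Fin 2) :
    adToC w (algebraMap k (Ad k) a) * (locEntry q a b ε w g I 0 * conj (locEntry q a b ε w g J 0)) +
      adToC w (algebraMap k (Ad k) (ε * b)) * (locEntry q a b ε w g I 1 * conj (locEntry q a b ε w g J 1)) =
      if I = J then (if I = 0 then adToC w (algebraMap k (Ad k) a) else adToC w (algebraMap k (Ad k) (ε * b)))
        else 0 := by
  have hblk := unitary_block_eq q a b ε g I J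
  rw [blocks_eq_blockOf, blocks_eq_blockOf, blocks_eq_blockOf, blocks_eq_blockOf] at hblk
  obtain ⟨hp, hs⟩ := block_unitary_scalar (isUnit_disc q hq) isUnit_two_Ad hblk
  rw [locEntry_eq_blockWeight', locEntry_eq_blockWeight', locEntry_eq_blockWeight', locEntry_eq_blockWeight',
    ← blockWeight_mul_conj q w hw hcm, ← blockWeight_mul_conj q w hw hcm]
  generalize haA : algebraMap k (Ad k) a = aA at hp hs ⊢
  generalize hbA : algebraMap k (Ad k) (ε * b) = bA at hp hs ⊢
  -- read both scalar identities in `ℂ`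
  have hC := congrArg (adToC w) hp
  have hS := congrArg (adToC w) hs
  have hd : adToC w (if I = J then (if I = 0 then aA else bA) else 0) =
      if I = J then (if I = 0 then adToC w aA else adToC w bA) else 0 := by
    split_ifs <;> simp
  rw [hd] at hC
  simp only [map_add, map_mul, map_sub, map_zero, adToC_t, adToC_n] at hC hS
  simp only [blockWeight, map_add, map_mul, map_sub, adToC_t, adToC_n]
  linear_combination hC + hS * wroot q w

/-- The diagonal matrix `J = diag (a_w, ε_w b_w)` of the local Hermitian form. -/
def Jdiag : Matrix (Fin 2) (Fin 2) ℂ :=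
  Matrix.diagonal ![adToC w (algebraMap k (Ad k) a), adToC w (algebraMap k (Ad k) (ε * b))]

/-- **THE UNITARY RELATION IN COORDINATES**: `locMat g * J * (locMat g)ᴴ = J` at a real CM place
(`hq : 4 n − t² ≠ 0` holds whenever one real CM place exists). -/
theorem locMat_mul_J_mul_star (hw : w.IsReal) (hcm : IsCMAt q w) (hq : 4 * q.n - q.t ^ 2 ≠ 0)
    (g : GA (PlaneData.ofLinesRow q a b ε)) :
    locMat q a b ε w g * Jdiag a b ε w * (locMat q a b ε w g)ᴴ = Jdiag a b ε w := by
  ext I J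
  have h := locEntry_unitary q a b ε w hw hcm hq g I J
  fin_cases I <;> fin_cases J <;>
    simp [Jdiag, Matrix.mul_apply, Fin.sum_univ_two, locMat_apply, Matrix.diagonal, Matrix.conjTranspose_apply]
      at h ⊢ <;>
    linear_combination h

/-! ## 2. Scalar consequences: `a_w |α|² + ε_w b_w |β|² = a_w`, `|α| ≥ 1`, `α ≠ 0`; the inverse -/

/-- **Row `0` of the unitary relation in real terms**: `a_w ‖α‖² + ε_w b_w ‖β‖² = a_w`
(`Complex.normSq`, the coefficients read as real numbers). -/
theorem normSq_entry_sub_normSq (hw : w.IsReal) (hcm : IsCMAt q w) (hq : 4 * q.n - q.t ^ 2 ≠ 0)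
    (g : GA (PlaneData.ofLinesRow q a b ε)) :
    (adToC w (algebraMap k (Ad k) a)).re * Complex.normSq (locEntry q a b ε w g 0 0) +
      (adToC w (algebraMap k (Ad k) (ε * b))).re * Complex.normSq (locEntry q a b ε w g 0 1) =
      (adToC w (algebraMap k (Ad k) a)).re := by
  have h := locEntry_unitary q a b ε w hw hcm hq g 0 0
  simp only [if_true, Complex.mul_conj] at h
  have h' := congrArg Complex.re h
  simp only [Complex.add_re, Complex.mul_re, Complex.ofReal_re, Complex.ofReal_im, mul_zero, sub_zero] at h'
  exact h'

/-- **`‖α‖² ≥ 1` on `U(1,1)`**: when `a_w > 0` and `ε_w b_w < 0` (the signature `(1,1)` at `w`). -/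
theorem one_le_normSq_locEntry_zero_zero (hw : w.IsReal) (hcm : IsCMAt q w) (hq : 4 * q.n - q.t ^ 2 ≠ 0)
    (ha : 0 < (adToC w (algebraMap k (Ad k) a)).re) (hb : (adToC w (algebraMap k (Ad k) (ε * b))).re < 0)
    (g : GA (PlaneData.ofLinesRow q a b ε)) : 1 ≤ Complex.normSq (locEntry q a b ε w g 0 0) := by
  have h := normSq_entry_sub_normSq q a b ε w hw hcm hq g
  have hβ := Complex.normSq_nonneg (locEntry q a b ε w g 0 1)
  by_contra hlt
  have hlt' : Complex.normSq (locEntry q a b ε w g 0 0) < 1 := lt_of_not_ge hlt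
  nlinarith [mul_nonneg (neg_nonneg.2 hb.le) hβ]

/-- **`‖α‖ ≥ 1` on `U(1,1)`**. -/
theorem one_le_norm_locEntry_zero_zero (hw : w.IsReal) (hcm : IsCMAt q w) (hq : 4 * q.n - q.t ^ 2 ≠ 0)
    (ha : 0 < (adToC w (algebraMap k (Ad k) a)).re) (hb : (adToC w (algebraMap k (Ad k) (ε * b))).re < 0)
    (g : GA (PlaneData.ofLinesRow q a b ε)) : 1 ≤ ‖locEntry q a b ε w g 0 0‖ := by
  have h := one_le_normSq_locEntry_zero_zero q a b ε w hw hcm hq ha hb g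
  rw [Complex.normSq_eq_norm_sq] at h
  nlinarith [norm_nonneg (locEntry q a b ε w g 0 0)]

/-- **`α ≠ 0` on `U(1,1)`**. -/
theorem locEntry_zero_zero_ne_zero (hw : w.IsReal) (hcm : IsCMAt q w) (hq : 4 * q.n - q.t ^ 2 ≠ 0)
    (ha : 0 < (adToC w (algebraMap k (Ad k) a)).re) (hb : (adToC w (algebraMap k (Ad k) (ε * b))).re < 0)
    (g : GA (PlaneData.ofLinesRow q a b ε)) : locEntry q a b ε w g 0 0 ≠ 0 := by
  intro h0
  have h := one_le_normSq_locEntry_zero_zero q a b ε w hw hcm hq ha hb g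
  rw [h0, map_zero] at h
  exact absurd h (by norm_num)

/-- `locMat g⁻¹ * locMat g = 1`. -/
theorem locMat_inv_mul (hw : w.IsReal) (hcm : IsCMAt q w) (g : GA (PlaneData.ofLinesRow q a b ε)) :
    locMat q a b ε w g⁻¹ * locMat q a b ε w g = 1 := by
  rw [← locMat_mul q a b ε w hw hcm, inv_mul_cancel, locMat_one]

/-- `locMat g * locMat g⁻¹ = 1`. -/
theorem locMat_mul_inv (hw : w.IsReal) (hcm : IsCMAt q w) (g : GA (PlaneData.ofLinesRow q a b ε)) :
    locMat q a b ε w g * locMat q a b ε w g⁻¹ = 1 := by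
  rw [← locMat_mul q a b ε w hw hcm, mul_inv_cancel, locMat_one]

/-- **The coordinates of `g⁻¹`**: `locMat g⁻¹ * J = J * (locMat g)ᴴ` (from the unitary relation, cancelling
`locMat g` on the left). -/
theorem locMat_inv_mul_J (hw : w.IsReal) (hcm : IsCMAt q w) (hq : 4 * q.n - q.t ^ 2 ≠ 0)
    (g : GA (PlaneData.ofLinesRow q a b ε)) :
    locMat q a b ε w g⁻¹ * Jdiag a b ε w = Jdiag a b ε w * (locMat q a b ε w g)ᴴ := by
  have h := locMat_mul_J_mul_star q a b ε w hw hcm hq g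
  calc locMat q a b ε w g⁻¹ * Jdiag a b ε w
      = locMat q a b ε w g⁻¹ * (locMat q a b ε w g * Jdiag a b ε w * (locMat q a b ε w g)ᴴ) := by rw [h]
    _ = (locMat q a b ε w g⁻¹ * locMat q a b ε w g) * Jdiag a b ε w * (locMat q a b ε w g)ᴴ := by
        simp only [Matrix.mul_assoc]
    _ = Jdiag a b ε w * (locMat q a b ε w g)ᴴ := by rw [locMat_inv_mul q a b ε w hw hcm, Matrix.one_mul]

/-- **`α(g⁻¹) = conj α(g)`** when `a_w ≠ 0`. -/
theorem locEntry_inv_zero_zero (hw : w.IsReal) (hcm : IsCMAt q w) (hq : 4 * q.n - q.t ^ 2 ≠ 0)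
    (ha : adToC w (algebraMap k (Ad k) a) ≠ 0) (g : GA (PlaneData.ofLinesRow q a b ε)) :
    locEntry q a b ε w g⁻¹ 0 0 = conj (locEntry q a b ε w g 0 0) := by
  have h := congrFun (congrFun (locMat_inv_mul_J q a b ε w hw hcm hq g) 0) 0
  simp [Jdiag, Matrix.mul_apply, locMat_apply, Matrix.diagonal, Matrix.conjTranspose_apply] at h
  exact mul_right_cancel₀ ha (by linear_combination h)

end Unitary

end Summit.Ventures.HodgeRepro.Tier4.Common

end
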